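import Literature.AlgebraicGeometry.HodgeTheory.UnitaryReflectionPairInfinite
import Literature.AlgebraicGeometry.HodgeTheory.ZariskiClosureBaseChange
import HarnessLib

/-!
# Complexification of a rational quadratic space with an automorphism of finite order: the hermitian form
# `h(x,y) = B(x̄, y)` and the eigenspaces (Carlson–Toledo 1999 §§2, 5: `H^{n+1}(Y,ℂ)₀ = ⊕_μ H(μ)`,
# "unitary with respect to the hermitian form `h(x,y) = i^{n+1}(x, ȳ)`") — packaging, part 1

Family `hodge`, layer `Literature/AlgebraicGeometry/HodgeTheory`. The crux K1 of
`Summits/HodgeConjecture/HodgeConjecture/Theses/CyclicUnitaryPowers.lean` is stated on `V = H²(X;ℚ)` with the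
`ℚ`-bilinear form `B = tr ∘ ∪` and the deck transformation `τ` (`τ^p = 1`); the density theorem it rests
on (Carlson–Toledo §7, the tree's `carlsonToledo1999_unitaryReflection_zariskiDense`) lives on the
EIGENSPACES `H(μ) ⊂ V ⊗ ℂ` with the HERMITIAN form `h(x,y) = B(x̄,y)` (the source's `i^{n+1}(x,ȳ)` up to the
order of arguments; Mathlib's sesquilinear forms are conjugate-linear in the first slot). This file is the
first half of that packaging ("R1" of memo STUB-PLAN-B2-g19 §2 / (a) of LANE-D-ROADMAP-Ax-g0): the
conjugation `x ↦ x̄` of `ℂ ⊗_ℚ V`, the hermitian form `h`, its symmetry, and the two compatibilities every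
consumer needs — a RATIONAL `B`-isometry is `h`-unitary, and a rational map commuting with `τ` preserves the
eigenspaces of `τ ⊗ ℂ`. Written by the prover seat `hodge-nonav-prover-Ax` (cell `hodge-nonav`).
`-- TODO(part 2): eigenspace projectors (1/p) Σ μ^{-ij} τ^i, non-degeneracy of h on each H(μ), the
restricted reflections = complexReflection, the orbit Δ_j and the verification of udensitytheo's hypotheses.`

## What is here (V a `ℚ`-space, `B : BilinForm ℚ V`)
* `conjV V : ℂ ⊗_ℚ V →ₗ⋆[ℂ] ℂ ⊗_ℚ V` — complex conjugation `c ⊗ v ↦ c̄ ⊗ v` (conjugate-linear; DEFINITION),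
  `conjV_tmul`, `conjV_conjV` (involution), `conjV_baseChange` (rational maps commute with conjugation).
* `hermitianOfBilin B : ℂ ⊗ V →ₗ⋆[ℂ] ℂ ⊗ V →ₗ[ℂ] ℂ`, `h(x,y) := B_ℂ(x̄, y)` (DEFINITION), with
  `baseChange_conjV_conjV` (`B_ℂ(x̄,ȳ) = conj B_ℂ(x,y)`), **`isSymm_hermitianOfBilin`** (`h` is hermitian for
  `B` symmetric), **`hermitianOfBilin_baseChange`** (`h(g x, g y) = h(x,y)` for a rational `B`-isometry `g`).
* **`baseChange_mem_eigenspace_of_comm`** — if `g τ = τ g` on `V` then `g ⊗ ℂ` maps each eigenspace of `τ ⊗ ℂ`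
  into itself; `baseChange_mem_submoduleStabilizer_eigenspace` (the tree's `submoduleStabilizer`).

## References
* [CarlsonToledo1999] J. A. Carlson, D. Toledo, Duke Math. J. 97 (1999): §2 (p. 5: "`H^{n+1}(Y,ℂ)₀ = ⊕ H(μ)`",
  "unitary with respect to the hermitian form `h(x,y) = i^{n+1}(x, ȳ)`"), §5 (p. 11), §7.
* [Borel1991] A. Borel, *Linear Algebraic Groups*, AG §14 (complexification, `k`-structures and conjugation).
-/

noncomputable section

open Module Literature.AlgebraicGeometry.Motives
open scoped TensorProduct ComplexConjugate

namespace Literature.AlgebraicGeometry.HodgeTheory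

universe v

variable (V : Type v) [AddCommGroup V] [Module ℚ V]

/-! ### §1 Complex conjugation on `ℂ ⊗_ℚ V` -/

/-- Complex conjugation of `ℂ` as a `ℚ`-linear map. [cite: Borel1991, AG §14.1] -/
def conjRat : ℂ →ₗ[ℚ] ℂ := ((starRingEnd ℂ).toRatAlgHom).toLinearMap

/-- [cite: Borel1991, AG §14.1] -/
@[simp] theorem conjRat_apply (c : ℂ) : conjRat c = conj c := rfl

/-- **Complex conjugation `x ↦ x̄` on `V ⊗ ℂ`**, `c ⊗ v ↦ c̄ ⊗ v`, a conjugate-linear map (the real structure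
`V ⊗ ℝ ⊂ V ⊗ ℂ`; Carlson–Toledo's `ȳ`). [cite: CarlsonToledo1999, §2 (p. 5)] [cite: Borel1991, AG §14.1] -/
def conjV : ℂ ⊗[ℚ] V →ₗ⋆[ℂ] ℂ ⊗[ℚ] V where
  toFun := (conjRat).rTensor V
  map_add' x y := map_add _ x y
  map_smul' c x := by
    induction x using TensorProduct.induction_on with
    | zero => simp
    | tmul a v =>
      simp only [TensorProduct.smul_tmul', LinearMap.rTensor_tmul, conjRat_apply, smul_eq_mul, map_mul]
    | add x y hx hy => rw [smul_add, map_add, hx, hy, map_add, smul_add]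

variable {V}

/-- [cite: Borel1991, AG §14.1] -/
@[simp] theorem conjV_tmul (c : ℂ) (v : V) : conjV V (c ⊗ₜ v) = conj c ⊗ₜ v := by
  change (conjRat).rTensor V (c ⊗ₜ v) = _
  rw [LinearMap.rTensor_tmul, conjRat_apply]

/-- Conjugation is an involution. [cite: Borel1991, AG §14.1] -/
@[simp] theorem conjV_conjV (x : ℂ ⊗[ℚ] V) : conjV V (conjV V x) = x := by
  induction x using TensorProduct.induction_on with
  | zero => simp
  | tmul a v => rw [conjV_tmul, conjV_tmul, Complex.conj_conj]
  | add x y hx hy => rw [map_add, map_add, hx, hy]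

/-- **Rational maps commute with conjugation**: `conj (g_ℂ x) = g_ℂ (conj x)` for `g : V →ₗ[ℚ] V`.
[cite: Borel1991, AG §14.2] -/
theorem conjV_baseChange (g : V →ₗ[ℚ] V) (x : ℂ ⊗[ℚ] V) :
    conjV V (g.baseChange ℂ x) = g.baseChange ℂ (conjV V x) := by
  induction x using TensorProduct.induction_on with
  | zero => simp
  | tmul a v => rw [LinearMap.baseChange_tmul, conjV_tmul, conjV_tmul, LinearMap.baseChange_tmul]
  | add x y hx hy => rw [map_add, map_add, hx, hy, map_add, map_add]

/-! ### §2 The hermitian form `h(x,y) = B(x̄, y)` -/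

/-- **The hermitian form of a rational bilinear form**: `h(x, y) := B_ℂ(x̄, y)` on `V ⊗ ℂ` (conjugate-linear
in `x`, linear in `y` — Mathlib's convention; Carlson–Toledo's "`h(x,y) = i^{n+1}(x, ȳ)`" for `n + 1` even,
up to the order of the arguments). [cite: CarlsonToledo1999, §2 (p. 5) and §5 (p. 11)] -/
def hermitianOfBilin (B : LinearMap.BilinForm ℚ V) : ℂ ⊗[ℚ] V →ₗ⋆[ℂ] ℂ ⊗[ℚ] V →ₗ[ℂ] ℂ :=
  LinearMap.comp (B.baseChange ℂ : ℂ ⊗[ℚ] V →ₗ[ℂ] ℂ ⊗[ℚ] V →ₗ[ℂ] ℂ) (conjV V)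

/-- [cite: CarlsonToledo1999, §2 (p. 5)] -/
@[simp] theorem hermitianOfBilin_apply (B : LinearMap.BilinForm ℚ V) (x y : ℂ ⊗[ℚ] V) :
    hermitianOfBilin B x y = B.baseChange ℂ (conjV V x) y := rfl

/-- `B_ℂ(x̄, ȳ) = conj B_ℂ(x, y)`: the base change of a RATIONAL form commutes with conjugation.
[cite: Borel1991, AG §14.2] -/
theorem baseChange_conjV_conjV (B : LinearMap.BilinForm ℚ V) (x y : ℂ ⊗[ℚ] V) :
    B.baseChange ℂ (conjV V x) (conjV V y) = conj (B.baseChange ℂ x y) := by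
  induction x using TensorProduct.induction_on with
  | zero => simp
  | tmul a v =>
    induction y using TensorProduct.induction_on with
    | zero => simp
    | tmul a' v' =>
      rw [conjV_tmul, conjV_tmul, LinearMap.BilinForm.baseChange_tmul, LinearMap.BilinForm.baseChange_tmul,
        map_rat_smul, map_mul]
    | add y y' hy hy' => simp only [map_add, hy, hy']
  | add x x' hx hx' => simp only [map_add, LinearMap.add_apply, hx, hx']

/-- **`h` is hermitian** (`conj h(x,y) = h(y,x)`) when `B` is symmetric. [cite: CarlsonToledo1999, §5 (p. 11)] -/
theorem isSymm_hermitianOfBilin {B : LinearMap.BilinForm ℚ V} (hB : B.IsSymm) : (hermitianOfBilin B).IsSymm := by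
  refine ⟨fun x y => ?_⟩
  rw [hermitianOfBilin_apply, hermitianOfBilin_apply, ← baseChange_conjV_conjV, conjV_conjV]
  have h := (LinearMap.BilinForm.IsSymm.baseChange (A := ℂ) (LinearMap.BilinForm.isSymm_iff.1 hB)).eq (conjV V y) x
  rw [RingHom.id_apply] at h
  exact h.symm

/-- A rational `B`-isometry is a `B_ℂ`-isometry. [cite: CarlsonToledo1999, §2 (p. 5)] -/
theorem baseChange_isometry {B : LinearMap.BilinForm ℚ V} {g : V →ₗ[ℚ] V}
    (hg : ∀ v w, B (g v) (g w) = B v w) (x y : ℂ ⊗[ℚ] V) :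
    B.baseChange ℂ (g.baseChange ℂ x) (g.baseChange ℂ y) = B.baseChange ℂ x y := by
  induction x using TensorProduct.induction_on with
  | zero => simp
  | tmul a v =>
    induction y using TensorProduct.induction_on with
    | zero => simp
    | tmul a' v' =>
      rw [LinearMap.baseChange_tmul, LinearMap.baseChange_tmul, LinearMap.BilinForm.baseChange_tmul,
        LinearMap.BilinForm.baseChange_tmul, hg]
    | add y y' hy hy' => simp only [map_add, hy, hy']
  | add x x' hx hx' => simp only [map_add, LinearMap.add_apply, hx, hx']

/-- **A rational `B`-isometry is `h`-unitary**: `h(g x, g y) = h(x, y)` for `g : V →ₗ[ℚ] V` with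
`B(g v, g w) = B(v, w)`. [cite: CarlsonToledo1999, §2 (p. 5)] -/
theorem hermitianOfBilin_baseChange {B : LinearMap.BilinForm ℚ V} {g : V →ₗ[ℚ] V}
    (hg : ∀ v w, B (g v) (g w) = B v w) (x y : ℂ ⊗[ℚ] V) :
    hermitianOfBilin B (g.baseChange ℂ x) (g.baseChange ℂ y) = hermitianOfBilin B x y := by
  rw [hermitianOfBilin_apply, hermitianOfBilin_apply, conjV_baseChange, baseChange_isometry hg]

/-- The same for a rational automorphism `g : V ≃ₗ[ℚ] V` and its base change `GL_ℚ(V) → GL_ℂ(V ⊗ ℂ)`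
(`glBaseChangeHom`). [cite: CarlsonToledo1999, §2 (p. 5)] -/
theorem hermitianOfBilin_glBaseChangeHom [Module.Finite ℚ V] {B : LinearMap.BilinForm ℚ V} {g : V ≃ₗ[ℚ] V}
    (hg : ∀ v w, B (g v) (g w) = B v w) (x y : ℂ ⊗[ℚ] V) :
    hermitianOfBilin B (glBaseChangeHom ℚ ℂ V g x) (glBaseChangeHom ℚ ℂ V g y) = hermitianOfBilin B x y := by
  have h := hermitianOfBilin_baseChange (g := (g : V →ₗ[ℚ] V)) hg x y
  rwa [← coe_glBaseChangeHom] at h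

/-! ### §3 Rational maps commuting with `τ` preserve the eigenspaces of `τ ⊗ ℂ` -/

/-- **If `g τ = τ g` on `V` then `g ⊗ ℂ` preserves every eigenspace `H(μ)` of `τ ⊗ ℂ`** (the eigenspace
decomposition `V ⊗ ℂ = ⊕ H(μ)` is respected by everything commuting with the cyclic automorphism:
"a linear map commutes with `σ` if and only if it preserves the eigenspace decomposition of `σ`", §2 p. 5).
[cite: CarlsonToledo1999, §2 (p. 5)] -/
theorem baseChange_mem_eigenspace_of_comm {τ g : V →ₗ[ℚ] V} (hc : g ∘ₗ τ = τ ∘ₗ g) (μ : ℂ)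
    {x : ℂ ⊗[ℚ] V} (hx : x ∈ Module.End.eigenspace (τ.baseChange ℂ) μ) :
    g.baseChange ℂ x ∈ Module.End.eigenspace (τ.baseChange ℂ) μ := by
  rw [Module.End.mem_eigenspace_iff] at hx ⊢
  have hcomm : (τ.baseChange ℂ) ∘ₗ (g.baseChange ℂ) = (g.baseChange ℂ) ∘ₗ (τ.baseChange ℂ) := by
    rw [← LinearMap.baseChange_comp, ← LinearMap.baseChange_comp, hc]
  have h := congrArg (fun f => f x) hcomm
  simp only [LinearMap.coe_comp, Function.comp_apply] at h
  rw [h, hx, map_smul]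

/-- The automorphism version: for `g : V ≃ₗ[ℚ] V` commuting with `τ`, `g ⊗ ℂ` lies in the stabiliser
(the tree's `submoduleStabilizer`) of every eigenspace of `τ ⊗ ℂ`. [cite: CarlsonToledo1999, §2 (p. 5)] -/
theorem glBaseChangeHom_mem_submoduleStabilizer_eigenspace [Module.Finite ℚ V] {τ : V →ₗ[ℚ] V}
    {g : V ≃ₗ[ℚ] V} (hc : (g : V →ₗ[ℚ] V) ∘ₗ τ = τ ∘ₗ (g : V →ₗ[ℚ] V)) (μ : ℂ) :
    glBaseChangeHom ℚ ℂ V g ∈ submoduleStabilizer (Module.End.eigenspace (τ.baseChange ℂ) μ) := by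
  rw [mem_submoduleStabilizer_iff]
  -- `g⁻¹` commutes with `τ` as well
  have hc' : ((g⁻¹ : V ≃ₗ[ℚ] V) : V →ₗ[ℚ] V) ∘ₗ τ = τ ∘ₗ ((g⁻¹ : V ≃ₗ[ℚ] V) : V →ₗ[ℚ] V) := by
    ext v
    have hw := congrArg (fun f => f (g.symm v)) hc
    simp only [LinearMap.coe_comp, Function.comp_apply, LinearEquiv.coe_coe, LinearEquiv.apply_symm_apply] at hw
    simp only [LinearMap.coe_comp, Function.comp_apply, LinearEquiv.coe_coe, LinearEquiv.coe_inv]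
    apply g.injective
    rw [LinearEquiv.apply_symm_apply, hw]
  have key : ∀ e : V ≃ₗ[ℚ] V, ((e : V →ₗ[ℚ] V) ∘ₗ τ = τ ∘ₗ (e : V →ₗ[ℚ] V)) →
      ∀ x ∈ Module.End.eigenspace (τ.baseChange ℂ) μ,
        glBaseChangeHom ℚ ℂ V e x ∈ Module.End.eigenspace (τ.baseChange ℂ) μ := by
    intro e he x hx
    exact baseChange_mem_eigenspace_of_comm he μ hx
  intro x
  refine ⟨key g hc x, fun hx => ?_⟩
  have h := key g⁻¹ hc' _ hx
  rwa [map_inv, LinearEquiv.coe_inv, LinearEquiv.symm_apply_apply] at h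

/-! ### §4 Conjugation and `B_ℂ` against the eigenspaces of a `B`-isometry `τ` -/

/-- Conjugation carries the `μ`-eigenspace of `τ ⊗ ℂ` to the `μ̄`-eigenspace (`τ` is rational):
`H(μ̄) = conj H(μ)`, Carlson–Toledo's pairing of `H(μ)` with `H(μ̄)`. [cite: CarlsonToledo1999, §2 (p. 5)] -/
theorem conjV_mem_eigenspace {τ : V →ₗ[ℚ] V} {μ : ℂ} {x : ℂ ⊗[ℚ] V}
    (hx : x ∈ Module.End.eigenspace (τ.baseChange ℂ) μ) :
    conjV V x ∈ Module.End.eigenspace (τ.baseChange ℂ) (conj μ) := by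
  rw [Module.End.mem_eigenspace_iff] at hx ⊢
  rw [← conjV_baseChange, hx, LinearMap.map_smulₛₗ]

/-- **Eigenspaces of a `B`-isometry are `B_ℂ`-orthogonal unless the eigenvalues multiply to `1`**:
`B_ℂ(x, y) = 0` for `τx = μx`, `τy = μ'y`, `μμ' ≠ 1` (`B_ℂ(x,y) = B_ℂ(τx,τy) = μμ'B_ℂ(x,y)`).
[cite: CarlsonToledo1999, §5 (p. 11)] -/
theorem baseChange_eq_zero_of_mem_eigenspace {B : LinearMap.BilinForm ℚ V} {τ : V →ₗ[ℚ] V}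
    (hτ : ∀ v w, B (τ v) (τ w) = B v w) {μ μ' : ℂ} (h : μ * μ' ≠ 1) {x y : ℂ ⊗[ℚ] V}
    (hx : x ∈ Module.End.eigenspace (τ.baseChange ℂ) μ) (hy : y ∈ Module.End.eigenspace (τ.baseChange ℂ) μ') :
    B.baseChange ℂ x y = 0 := by
  rw [Module.End.mem_eigenspace_iff] at hx hy
  have key := baseChange_isometry hτ x y
  rw [hx, hy, map_smul, map_smul, LinearMap.smul_apply, smul_eq_mul, smul_eq_mul, ← mul_assoc, mul_comm μ' μ] at key
  -- `μ μ' B = B` with `μ μ' ≠ 1`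
  have h1 : (μ * μ' - 1) * B.baseChange ℂ x y = 0 := by rw [sub_mul, one_mul, key, sub_self]
  exact (mul_eq_zero.mp h1).resolve_left (sub_ne_zero.mpr h)

/-- **`h`-orthogonality of eigenspaces**: `h(x, y) = B_ℂ(x̄, y) = 0` for `τx = μx`, `τy = μ'y` unless
`μ̄ μ' = 1` — for eigenvalues on the unit circle (roots of unity), unless `μ' = μ`. So `h` restricted to
`H(μ)` only pairs `H(μ)` with itself: the hermitian spaces `(H(μ), h)` of Carlson–Toledo §5.
[cite: CarlsonToledo1999, §5 (p. 11)] -/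
theorem hermitianOfBilin_eq_zero_of_mem_eigenspace {B : LinearMap.BilinForm ℚ V} {τ : V →ₗ[ℚ] V}
    (hτ : ∀ v w, B (τ v) (τ w) = B v w) {μ μ' : ℂ} (h : conj μ * μ' ≠ 1) {x y : ℂ ⊗[ℚ] V}
    (hx : x ∈ Module.End.eigenspace (τ.baseChange ℂ) μ) (hy : y ∈ Module.End.eigenspace (τ.baseChange ℂ) μ') :
    hermitianOfBilin B x y = 0 := by
  rw [hermitianOfBilin_apply]
  exact baseChange_eq_zero_of_mem_eigenspace hτ h (conjV_mem_eigenspace hx) hy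

end Literature.AlgebraicGeometry.HodgeTheory

end
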